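import Summits.Ventures.PercRepro.RankLevelSetExplicitLin2Key
import Summits.Ventures.PercRepro.RankLevelSetLevelNinePartThree

/-!
# PercRepro — THE LEVEL-10 ROW OF C-025 FROM THE CHAIN'S OWN FLOOR `p ≥ 8 710` (p9, S4)

`proofs/SUBCLAIM-S4-p9.md` §S4.3⁗. THEOREM U states level `10` from `p ≥ 20 481` (`q·2^{q+1} + 1`). The assembled
inequality `(P_d)` of its chain holds, exactly evaluated, at EVERY core corank `11 ≤ d ≤ 1034` from `p = 8 710` — and fails at
`p = 8 709` (corank `629`): the integer key `KeyP 10 8710 d` (RankLevelSetExplicitLin2Key) is checked by the kernel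
at the 1 024 coranks (`decide`, 1 chunk of 1 024), the key is monotone in the rank (`keyP_mono`), and the wrapper
`c025_level_succ_of_keyP_row` assembles the level from p4's level-9 row `c025_nine_large_part3'` (`739 ≤ p`, ADDENDUM 55):
**`c025_ten_from_8710 (M) (p) (hp : 8710 ≤ p) : RLS M p 10`** — the level-10 threshold `20 481` of THEOREM U
becomes `8 710` (`0.425·q·2^{q+1}`), the floor of the counting method itself. Axioms: standard.
-/

open scoped Matroid

namespace PercRepro

namespace ThmN

namespace Explicit

/-- **THE KEY ROW AT `(q, p) = (10, 8 710)`**: `KeyP 10 8710 d` at every corank `11 ≤ d ≤ 1034`, by the kernel. -/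
theorem key_ten_row : ∀ t < 1024, KeyP 10 8710 (11 + t) := by decide +kernel

/-- **THE FLOOR IS EXACT**: the key FAILS at `p = 8 709`, corank `629` (the big class's saturation corank), by the kernel. -/
theorem key_ten_sharp : ¬ KeyP 10 8709 629 := by decide +kernel

end Explicit

variable {α : Type}

/-- **THE LEVEL-10 ROW FROM `8 710`**: C-025 at level `10` for every finite matroid and every `p ≥ 8 710` — the key row
at `8 710`, its monotonicity in `p`, the wrapper `c025_level_succ_of_keyP_row` (`N₁(10) = 2 292`, tail `3 137`) and
p4's level-9 row `c025_nine_large_part3'` (`739 ≤ p`, ADDENDUM 55) at `p − 1`. -/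
theorem c025_ten_from_8710 (M : Matroid α) [M.Finite] (p : ℕ) (hp : 8710 ≤ p) : RLS M p 10 :=
  c025_level_succ_of_keyP_row 9 (by norm_num) 8710 (by norm_num) (by norm_num) Explicit.key_ten_row
    (fun M' _ p' hp' => c025_nine_large_part3' M' p' (by omega)) M p hp

/-- The same in the literal `C025` body: `phiK p 10 · #U(p, 10) ≤ #Y(p, 10)` for every finite matroid and every `p ≥ 8 710`. -/
theorem c025_ten_from_8710' (M : Matroid α) [M.Finite] (p : ℕ) (hp : 8710 ≤ p) :
    phiK p 10 * ({A : Set α | A ⊆ M.E ∧ M.eRk A = (p : ℕ∞) ∧ M.eRk (M.E \ A) = (10 : ℕ∞)}.ncard : ℚ) ≤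
      ({A : Set α | A ⊆ M.E ∧ (10 : ℕ∞) < M.eRk A ∧ M.eRk A < (p : ℕ∞)}.ncard : ℚ) :=
  c025_ten_from_8710 M p hp

end ThmN

end PercRepro
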